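import Summits.QuantumFields.BalabanUV.T4Continuum.Support.NE3NestedBlockMeanCovariance
import Summits.QuantumFields.BalabanUV.T4Continuum.Support.GaugeFieldPerturbation
import HarnessLib
/-!
# T⁴ programme, node NE3, route H♮ (ρ-g22-2) · junction J-ne3r2-g8-1 (J4, ruling ρ-g23-1 (2)), file 3∕3 — THE k-FOLD AVERAGED BOND
# AGAINST THE STRAIGHT `M`-SEGMENT: `‖cavgIter L (j+1) W z κ − bseg (L^{j+1}) W z κ‖ ≤ (4∕10)·DSum d L (j+1) x ≤ 8·loopRad(d,L,r_j)`

Row NE3-R2 (unit `b2b-balaban-t4-ne3r2-p1`, gen 8).  WHY.  K4-c file 2 of route H♮ (the Landau kill = covariant block divergence theorem,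
owner `t4-ne3-p1-g23`) is stated for a GENERAL unitary coarse field `U` and carries the explicit coarse-transport mismatch
`Σ_κ (Ad (U (z−e_κ) κ)⁻¹ − Ad (bseg M W (z−e_κ) κ)⁻¹)(farFlux …)`; at the consumer's `U = cavgIter L k W` its size is
`2‖cavgIter L k W (z−e_κ) κ − bseg (L^k) W (z−e_κ) κ‖·ℓ¹(face)` (ρ-g23-1 (2): «call it J4 … the same induction»).  THIS FILE (all
[folklore]; 0 `def`, 0 sorry): `hol_seg_add` (additivity of straight segments), `hol_bseg_seg` (the straight `K`-segment of the
CONFIGURATION of straight `L`-segments is the straight `LK`-segment), **`norm_cavgIter_sub_bseg_le`** (`≤ (4∕10)·DSum d L (j+1) x`, `L ≥ 1`,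
multi-level small-field class: per level the straight `L^{j+1}`-segment of `W` is the `L^j`-segment of `bseg L W`, against the `L^j`-segment of
`cavg L W` it telescopes bondwise — file 1 `norm_cavg_sub_bseg_le` (`‖V̄(c) − U(Γ_c)‖ ≤ 4·loopRad`) and the tree's
`GaugeFieldPerturbation.norm_hol_sub_hol_le_of_forall`, weight `L^j` = number of sub-segments — then the induction hypothesis at `cavg L W`;
the weights are EXACTLY leaf-04's `NE3ExactLineSumsTower.DSum`), **`norm_cavgIter_sub_bseg_le_top`** (`≤ 8·loopRad(d,L,(prop1Radius)^[j] x)`,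
`L ≥ 2`, by `DSum_le_top` — only the TOP radius enters: k-FREE).

HONEST FRAMING.  Bookkeeping kinematics of OUR transported block means at a background in the multi-level small-field class; nothing
about Bałaban's minimisers; (P♮)_W, (ML_w) at `W ≠ 1`, T-E_w and NE3 are NOT proved here; spine PROVED 0∕9; finite T⁴ rung (B)+1 —
NOT infinite volume, NOT mass gap, NOT BetaPertH, NOT Clay.  ABSOLUTE RULE kept: no printed sentence is a hypothesis (context only:
[Balaban1985Averaging] (8) p. 18, (42)–(45) pp. 23–25).  PLACEMENT: `Summits/QuantumFields/BalabanUV/`; moves nothing.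
HONEST DEPENDENCY: continuum YM on T⁴ ⇐ BetaPertH ∧ nine spine estimates (0/9 proved); BetaPertH ⇐ (D1) ∧ (D4) ∧ CAP+tail;
G-an2-4 gates asym, D1 and NE2/3/4.
-/

set_option autoImplicit false

open scoped BigOperators Matrix.Norms.L2Operator
open Finset

namespace Summit.QuantumFields.BalabanUV.T4Continuum.NE3TowerBondVsSegment

open Literature.MathematicalPhysics.QuantumFieldTheory.Balaban1983to89
open B7Prop1Explicit B7Prop2Explicit
open T4AveragingDeficitWall (IsUnitaryCfg SmallField Ad hol_flat bavg_flat)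
open T4AveragingDeficitNonAbelian (Ad_mul Ad_sub)
open AveragingDeficitTransport (norm_Ad_of_unitary mem_U1_of_unitary)
open AveragingDeficitNearIdentity (Ad_one norm_Ad_sub_le norm_hol_sub_one_le_of_bonds Ad_sum Ad_real_smul)
open AveragingDeficitChartCalculus (cavg)
open AveragingDeficitTwoLevelPrep (prop1Radius)
open AveragingDeficitMultiLevelPrep (cavgIter LevelSmall prop1Radius_nonneg)
open AveragingDeficitBlockDensity (btree bseg btree_mem norm_cavg_inv_bseg_sub_one_le cavg_mem)
open AveragingDeficitLocality (bondsOf)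
open AveragingDeficitTransportCalc (bondsOf_append mem_bondsOf_seg_iff)
open NE3TangentCovariantTower (step_small cavgIter_succ)
open NE3CovariantBlockMean (bmeanW bmeanIterW bmeanIterW_succ bmeanIterW_zero boxVec_bounds)
open NE3GaugeDirFrames (Ad_Ad_inv)
open NE3CombGauge (btree_corner norm_comb_sub_one_le_single isUnitaryCfg_comb smallField_comb)
open NE3FramePotGauge (bmean iterate_bmean_apply)
open NE3ExactLineSumsTower (sq_mul_loopRad_le DSum DSum_succ DSum_le_top)
open NE3ExactLineSums (blockMean_norm_sq_le)
open NE3BlockLineAverage (sum_univ_boxVec sum_periodBox_blocks)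
open SpreadLift (loopRad loopRad_le loopBound_of_smallField)
open T4AveragingDeficitWallBoundary (periodBox mem_periodBox)

open NE3NestedBlockMeanCovariance
open GaugeFieldPerturbation (norm_hol_sub_hol_le_of_forall)

noncomputable section

variable {d : ℕ} {n : Type*} [Fintype n] [DecidableEq n]

/-! ## §6 (J4) The k-fold averaged bond against the straight `M`-segment -/

/-- Additivity of straight forward segments: `V([z, z + (m+n)e_κ]) = V([z, z + m e_κ])·V([z + m e_κ, z + (m+n) e_κ])`. [folklore] -/
theorem hol_seg_add {G : Type*} [Group G] (V : Site d → Fin d → G) (z : Site d) (κ : Fin d) (m : ℕ) :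
    ∀ n : ℕ, hol V z (seg κ ((m + n : ℕ) : ℤ)) = hol V z (seg κ (m : ℤ)) * hol V (z + (m : ℤ) • e κ) (seg κ (n : ℤ))
  | 0 => by simp
  | n + 1 => by
      rw [show ((m + (n + 1) : ℕ) : ℤ) = ((m + n : ℕ) : ℤ) + 1 by push_cast; ring, hol_seg_natCast_succ, hol_seg_add V z κ m n,
        show ((n + 1 : ℕ) : ℤ) = (n : ℤ) + 1 by push_cast; rfl, hol_seg_natCast_succ, mul_assoc, add_assoc, ← add_smul]
      push_cast
      rfl

/-- The straight segment of `K` steps of the CONFIGURATION of straight `L`-segments is the straight `LK`-segment: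
`hol (bseg L W) q [q, q + K e_κ] = W([L•q, L•q + LK e_κ])`. [folklore] -/
theorem hol_bseg_seg (L : ℕ) (W : Site d → Fin d → (Matrix n n ℂ)ˣ) (κ : Fin d) (q : Site d) :
    ∀ K : ℕ, hol (fun y ν => bseg L W y ν) q (seg κ (K : ℤ)) = hol W ((L : ℤ) • q) (seg κ ((L * K : ℕ) : ℤ))
  | 0 => by simp
  | K + 1 => by
      rw [show ((K + 1 : ℕ) : ℤ) = (K : ℤ) + 1 by push_cast; rfl, hol_seg_natCast_succ, hol_bseg_seg L W κ q K,
        show L * (K + 1) = L * K + L by ring, hol_seg_add]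
      unfold bseg
      congr 2
      rw [smul_add, smul_smul]
      push_cast
      rfl

/-- **(J4) THE k-FOLD AVERAGE AGAINST THE STRAIGHT `M`-SEGMENT** (multi-level small-field class, `L ≥ 1`):
`‖cavgIter L (j+1) W z κ − bseg (L^{j+1}) W z κ‖ ≤ (4∕10)·DSum d L (j+1) x` — per level the straight `L^{j+1}`-segment of `W` is the
straight `L^j`-segment of the configuration `bseg L W` (`hol_bseg_seg`), against the `L^j`-segment of `cavg L W` it telescopes bondwise
(`‖V̄(c) − U(Γ_c)‖ ≤ 4·loopRad`, `norm_hol_sub_hol_le_of_forall`: weight `L^j` = number of sub-segments), then the induction hypothesis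
at `cavg L W`; the weights are EXACTLY leaf-04's `DSum` (K3 file 2). K4-c file 2's coarse-transport mismatch at `U = cavgIter L k W`
is `2·(this)·ℓ¹(face flux)`. [cite: Balaban1985Averaging, (42) p.23, p.25] -/
theorem norm_cavgIter_sub_bseg_le [Nonempty n] {L : ℕ} (hL : 1 ≤ L) (j : ℕ) :
    ∀ {W : Site d → Fin d → (Matrix n n ℂ)ˣ} {x : ℝ}, IsUnitaryCfg W → 0 ≤ x → LevelSmall d L j x → SmallField W x →
    ∀ (z : Site d) (κ : Fin d),
      ‖((cavgIter L (j + 1) W z κ : (Matrix n n ℂ)ˣ) : Matrix n n ℂ) - bseg (L ^ (j + 1)) W z κ‖ ≤ 4 / 10 * DSum d L (j + 1) x := by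
  induction j with
  | zero =>
      intro W x hWu hx hsm hWx z κ
      obtain ⟨h512, -, -, -⟩ := step_small hL hWu hx hsm hWx
      rw [cavgIter_succ, DSum_succ]
      simp only [AveragingDeficitMultiLevelPrep.cavgIter, zero_add, pow_one, pow_zero, one_mul, DSum, add_zero]
      have h := norm_cavg_sub_bseg_le hL hWu hx h512 hWx z κ
      linarith
  | succ j ih =>
      intro W x hWu hx hsm hWx z κ
      obtain ⟨h512, hW₁u, hr0, hW₁x⟩ := step_small hL hWu hx hsm.1 hWx
      rw [cavgIter_succ, DSum_succ]
      have h1 := ih hW₁u hr0 hsm.2 hW₁x z κ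
      -- the straight `L^{j+1}`-segment of `cavg L W` against that of the configuration `bseg L W` = the `L^{j+2}`-segment of `W`
      have hseg : bseg (L ^ (j + 1 + 1)) W z κ = hol (fun y ν => bseg L W y ν) (((L ^ (j + 1) : ℕ) : ℤ) • z) (seg κ ((L ^ (j + 1) : ℕ) : ℤ)) := by
        rw [hol_bseg_seg]
        unfold bseg
        congr 1
        · rw [smul_smul]; push_cast; ring_nf
        · push_cast; ring_nf
      have h2 : ‖((bseg (L ^ (j + 1)) (cavg L W) z κ : (Matrix n n ℂ)ˣ) : Matrix n n ℂ) - bseg (L ^ (j + 1 + 1)) W z κ‖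
          ≤ (L : ℝ) ^ (j + 1) * (4 * loopRad d L x) := by
        rw [hseg]
        unfold bseg
        have h := norm_hol_sub_hol_le_of_forall (W := fun y ν => hol W ((L : ℤ) • y) (seg ν L)) (W' := cavg L W)
          (fun y ν => mem_U1_of_unitary (hol_mem_of hWu _ _)) (fun y ν => mem_U1_of_unitary (cavg_mem hL hWu hx h512 hWx y ν))
          (fun y ν => norm_cavg_sub_bseg_le hL hWu hx h512 hWx y ν) (((L ^ (j + 1) : ℕ) : ℤ) • z) (seg κ ((L ^ (j + 1) : ℕ) : ℤ))
        rw [length_seg, Int.natAbs_natCast] at h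
        push_cast at h
        exact h
      calc ‖((cavgIter L (j + 1) (cavg L W) z κ : (Matrix n n ℂ)ˣ) : Matrix n n ℂ) - bseg (L ^ (j + 1 + 1)) W z κ‖
          ≤ ‖((cavgIter L (j + 1) (cavg L W) z κ : (Matrix n n ℂ)ˣ) : Matrix n n ℂ) - bseg (L ^ (j + 1)) (cavg L W) z κ‖
            + ‖((bseg (L ^ (j + 1)) (cavg L W) z κ : (Matrix n n ℂ)ˣ) : Matrix n n ℂ) - bseg (L ^ (j + 1 + 1)) W z κ‖ :=
            norm_sub_le_norm_sub_add_norm_sub _ _ _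
        _ ≤ 4 / 10 * DSum d L (j + 1) (prop1Radius d L x) + (L : ℝ) ^ (j + 1) * (4 * loopRad d L x) := add_le_add h1 h2
        _ = 4 / 10 * ((L : ℝ) ^ (j + 1) * (10 * loopRad d L x) + DSum d L (j + 1) (prop1Radius d L x)) := by ring

/-- **(J4) k-FREE**: `‖cavgIter L (j+1) W z κ − bseg (L^{j+1}) W z κ‖ ≤ 8·loopRad(d, L, (prop1Radius)^[j] x)` for `L ≥ 2` — only the TOP
radius enters (`DSum_le_top`). [cite: Balaban1985Averaging, (42) p.23, p.25] -/
theorem norm_cavgIter_sub_bseg_le_top [Nonempty n] {L : ℕ} (hL : 2 ≤ L) (j : ℕ) {W : Site d → Fin d → (Matrix n n ℂ)ˣ} {x : ℝ}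
    (hWu : IsUnitaryCfg W) (hx : 0 ≤ x) (hsm : LevelSmall d L j x) (hWx : SmallField W x) (z : Site d) (κ : Fin d) :
    ‖((cavgIter L (j + 1) W z κ : (Matrix n n ℂ)ˣ) : Matrix n n ℂ) - bseg (L ^ (j + 1)) W z κ‖
      ≤ 8 * loopRad d L ((prop1Radius d L)^[j] x) := by
  have h1 := norm_cavgIter_sub_bseg_le (by omega) j hWu hx hsm hWx z κ
  have h2 := DSum_le_top (d := d) hL j hx
  have hρ : 0 ≤ (L : ℝ) ^ j * (10 * loopRad d L x) := by unfold loopRad; positivity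
  linarith

end

end Summit.QuantumFields.BalabanUV.T4Continuum.NE3TowerBondVsSegment
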